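import Mathlib
import Literature.Analysis.FluidPDE.PoincareHomotopyOperatorL2
import Summits.NavierStokesRegularity.NavierStokesRegularity.Theorems.EulerZoomLiouvillePowerGaugeEulerLiouvilleSelfSimilarLEI
import Summits.NavierStokesRegularity.NavierStokesRegularity.Theorems.EulerZoomLiouvillePowerGaugeEulerLiouvilleSelfSimilarGauges
import HarnessLib

/-!
# Rung C1 of the crux `EulerZoomLiouville.PowerGaugeEulerLiouville`: the profile of an exactly
# self-similar member lies in `L³_loc`

Route №10 `EulerZoomLiouville` (NavierStokesRegularity), crux E = stmt-NavierStokesRegularity-19832,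
tenure rung C1 (exactly self-similar members).  Every suitable weak pair of the class has
`|u|³ ∈ L¹_loc` on the slab (tree `locallyIntegrableOn_cube_of_suitable`).  For an exactly
self-similar member `u(τ) = selfSimilarCollapse γ 0 V τ` this is inherited by the profile:
slicing the space–time integral over `[−2,−1] × B̄_n` (Tonelli) gives one time `τ₀` with every
slice integral `∫_{B_n} |u(τ₀)|³` finite, and the slice is a dilate of `V`.

* `lintegral_ball_enorm_cube_selfSimilarCollapse` — exact scaling of `∫_{B_a} ‖u(τ)‖³`;
* `locallyIntegrable_cube_profile` — `‖V‖³ ∈ L¹_loc(ℝ³)`.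

This removes the standing hypothesis `V ∈ L³_loc` from the member-level endpoint stratum
(`…SelfSimilarEndpointMember`).

WHAT THIS IS NOT: not NS, not E, not rung C1 — bookkeeping for self-similar members.
-/

noncomputable section

-- flat `Theorems/<Route><Decl>…` files of one crux share the namespace of the crux (tree convention)
set_option linter.dupNamespace false

open MeasureTheory Set Filter Topology Metric Function
open scoped ENNReal NNReal

namespace Summit.NavierStokesRegularity.NavierStokesRegularity.Theorems.PowerGaugeEulerLiouville

open Literature.Analysis Literature.Analysis.FluidPDE

section Cube

/-- **Ball integrals of `|u(τ)|³` for the ansatz (exact scaling, `ℝ≥0∞`).**  For `τ < 0`: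
`∫_{B_a} ‖u(τ,x)‖³ dx = (−τ)^{3(γ−1)} · ((−τ)^{−γ})^{−3} ∫_{B_{a(−τ)^{−γ}}} ‖V‖³`,
`u = selfSimilarCollapse γ 0 V` (tree `lintegral_ball_comp_smul`). [folklore] -/
theorem lintegral_ball_enorm_cube_selfSimilarCollapse (γ : ℝ) {τ : ℝ} (hτ : τ < 0)
    (V : EuclideanSpace ℝ (Fin 3) → EuclideanSpace ℝ (Fin 3)) (a : ℝ) :
    ∫⁻ x in ball (0 : EuclideanSpace ℝ (Fin 3)) a, ‖selfSimilarCollapse γ 0 V τ x‖ₑ ^ 3 =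
      ENNReal.ofReal (((-τ) ^ (γ - 1)) ^ 3) * (ENNReal.ofReal ((((-τ) ^ (-γ)) ^ 3)⁻¹) *
        ∫⁻ y in ball (0 : EuclideanSpace ℝ (Fin 3)) ((-τ) ^ (-γ) * a), ‖V y‖ₑ ^ 3) := by
  have hs : 0 < -τ := neg_pos.2 hτ
  have ht : 0 < (-τ) ^ (-γ) := Real.rpow_pos_of_pos hs _
  have h1 : ∀ x, ‖selfSimilarCollapse γ 0 V τ x‖ₑ ^ 3 =
      ENNReal.ofReal (((-τ) ^ (γ - 1)) ^ 3) * ‖V ((-τ) ^ (-γ) • x)‖ₑ ^ 3 := by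
    intro x
    rw [← ofReal_norm, norm_selfSimilarCollapse hτ, zero_sub, ← ofReal_norm (V _),
      ← ENNReal.ofReal_pow (by positivity), ← ENNReal.ofReal_pow (norm_nonneg _),
      ← ENNReal.ofReal_mul (by positivity), mul_pow]
  simp_rw [h1]
  rw [lintegral_const_mul' _ _ ENNReal.ofReal_ne_top,
    lintegral_ball_comp_smul (fun y => ‖V y‖ₑ ^ 3) ht a]

variable {u : ℝ → EuclideanSpace ℝ (Fin 3) → EuclideanSpace ℝ (Fin 3)}
  {p : ℝ → EuclideanSpace ℝ (Fin 3) → ℝ} {V : EuclideanSpace ℝ (Fin 3) → EuclideanSpace ℝ (Fin 3)}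
  {γ ν : ℝ}

/-- **The profile of an exactly self-similar suitable weak member lies in `L³_loc`.**  If
`(u, p)` is a suitable weak (Euler or Navier–Stokes) pair on the slab `(−∞,0) × ℝ³`, `u` is
a.e.-strongly measurable there and `u(τ) = selfSimilarCollapse γ 0 V τ` for `τ < 0`, then
`‖V‖³ ∈ L¹_loc(ℝ³)`: `|u|³ ∈ L¹_loc` on the slab (tree, from `u ∈ L^{10/3}_loc`), Tonelli over
`[−2,−1] × B̄_{n+1}` for all `n`, one good slice `τ₀`, and the dilation `y = (−τ₀)^{−γ} x`.
[cite: LemarieRieusset2016, (13.17)–(13.18) p. 461] -/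
theorem locallyIntegrable_cube_profile
    (hsw : IsSuitableWeakSolutionOn (slab (EuclideanSpace ℝ (Fin 3)) (Iio 0) isOpen_Iio) ν 0 u p)
    (hum : AEStronglyMeasurable (uncurry u)
      (volume.restrict (Iio (0 : ℝ) ×ˢ (univ : Set (EuclideanSpace ℝ (Fin 3))))))
    (hu : ∀ τ : ℝ, τ < 0 → u τ = selfSimilarCollapse γ 0 V τ) :
    LocallyIntegrable (fun y => ‖V y‖ ^ 3) volume := by
  have hVm : AEStronglyMeasurable V volume := aestronglyMeasurable_profile hum hu
  have hcube := locallyIntegrableOn_cube_of_suitable hsw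
  -- the boxes `K n = [−2,−1] × B̄_{n+1}`
  set I : Set ℝ := Icc (-2 : ℝ) (-1) with hI
  set K : ℕ → Set (ℝ × EuclideanSpace ℝ (Fin 3)) := fun n =>
    I ×ˢ closedBall (0 : EuclideanSpace ℝ (Fin 3)) ((n : ℝ) + 1) with hK
  have hKslab : ∀ n, K n ⊆ ((slab (EuclideanSpace ℝ (Fin 3)) (Iio 0) isOpen_Iio :
      TopologicalSpace.Opens (ℝ × EuclideanSpace ℝ (Fin 3))) : Set (ℝ × EuclideanSpace ℝ (Fin 3))) := by
    intro n z hz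
    rw [SetLike.mem_coe, mem_slab]
    have : z.1 ≤ -1 := (mem_prod.1 hz).1.2
    show z.1 < 0
    linarith
  have hKc : ∀ n, IsCompact (K n) := fun n => isCompact_Icc.prod (isCompact_closedBall _ _)
  -- `∫_{K n} ‖u‖ₑ³ < ∞`
  have hfin : ∀ n : ℕ, ∫⁻ z in K n, ‖u z.1 z.2‖ₑ ^ 3 < ⊤ := by
    intro n
    have h := (hcube.integrableOn_compact_subset (hKslab n) (hKc n)).2
    rw [hasFiniteIntegral_iff_enorm] at h
    refine lt_of_le_of_lt (le_of_eq (lintegral_congr fun z => ?_)) h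
    rw [Real.enorm_eq_ofReal (by positivity), ENNReal.ofReal_pow (norm_nonneg _), ofReal_norm]
  -- Tonelli on `K n`
  have hmeasK : ∀ n : ℕ, AEMeasurable (fun z : ℝ × EuclideanSpace ℝ (Fin 3) => ‖u z.1 z.2‖ₑ ^ 3)
      (((volume : Measure ℝ).restrict I).prod
        ((volume : Measure (EuclideanSpace ℝ (Fin 3))).restrict
          (closedBall (0 : EuclideanSpace ℝ (Fin 3)) ((n : ℝ) + 1)))) := by
    intro n
    have hsub : K n ⊆ Iio (0 : ℝ) ×ˢ (univ : Set (EuclideanSpace ℝ (Fin 3))) :=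
      fun z hz => mem_prod.2 ⟨by
        have : z.1 ≤ -1 := (mem_prod.1 hz).1.2
        show z.1 < 0
        linarith, mem_univ _⟩
    have h1 : AEStronglyMeasurable (uncurry u) (volume.restrict (K n)) :=
      hum.mono_measure (Measure.restrict_mono hsub le_rfl)
    rw [hK, Measure.volume_eq_prod, ← Measure.prod_restrict] at h1
    exact (h1.enorm.pow_const 3)
  have hslice : ∀ n : ℕ, ∀ᵐ τ ∂((volume : Measure ℝ).restrict I),
      ∫⁻ y in closedBall (0 : EuclideanSpace ℝ (Fin 3)) ((n : ℝ) + 1), ‖u τ y‖ₑ ^ 3 < ⊤ := by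
    intro n
    have h := hfin n
    rw [hK, Measure.volume_eq_prod, ← Measure.prod_restrict,
      lintegral_prod _ (hmeasK n)] at h
    exact ae_lt_top' (hmeasK n).lintegral_prod_right' h.ne
  rw [← ae_all_iff] at hslice
  -- a good time `τ₀ ∈ [−2,−1]`
  have hne : (ae ((volume : Measure ℝ).restrict I)).NeBot := by
    rw [ae_neBot, Ne, Measure.restrict_eq_zero, hI, Real.volume_Icc]; norm_num
  obtain ⟨τ₀, hτ₀, hτ₀I⟩ := (hslice.and (ae_restrict_mem measurableSet_Icc)).exists
  have hτ₀0 : τ₀ < 0 := by have := hτ₀I.2; linarith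
  have hs : 0 < -τ₀ := neg_pos.2 hτ₀0
  set d : ℝ := (-τ₀) ^ (-γ) with hd
  have hd0 : 0 < d := Real.rpow_pos_of_pos hs _
  -- every ball `B_{d(n+1)}` carries finite `‖V‖³`
  have hball : ∀ n : ℕ, ∫⁻ y in ball (0 : EuclideanSpace ℝ (Fin 3)) (d * ((n : ℝ) + 1)),
      ‖V y‖ₑ ^ 3 < ⊤ := by
    intro n
    have h1 : ∫⁻ y in ball (0 : EuclideanSpace ℝ (Fin 3)) ((n : ℝ) + 1), ‖u τ₀ y‖ₑ ^ 3 < ⊤ :=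
      lt_of_le_of_lt (lintegral_mono_set ball_subset_closedBall) (hτ₀ n)
    rw [hu τ₀ hτ₀0, lintegral_ball_enorm_cube_selfSimilarCollapse γ hτ₀0 V] at h1
    have hc1 : ENNReal.ofReal (((-τ₀) ^ (γ - 1)) ^ 3) ≠ 0 := by
      rw [ENNReal.ofReal_ne_zero_iff]; positivity
    have hc2 : ENNReal.ofReal ((((-τ₀) ^ (-γ)) ^ 3)⁻¹) ≠ 0 := by
      rw [ENNReal.ofReal_ne_zero_iff]; positivity
    rcases ENNReal.mul_lt_top_iff.1 h1 with ⟨-, h2⟩ | h | h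
    · rcases ENNReal.mul_lt_top_iff.1 h2 with ⟨-, h3⟩ | h' | h'
      · exact h3
      · exact absurd h' hc2
      · rw [h']; exact ENNReal.zero_lt_top
    · exact absurd h hc1
    · rcases mul_eq_zero.1 h with h' | h'
      · exact absurd h' hc2
      · rw [h']; exact ENNReal.zero_lt_top
  -- conclude
  rw [locallyIntegrable_iff]
  intro C hC
  obtain ⟨R, hCR⟩ := hC.isBounded.subset_closedBall (0 : EuclideanSpace ℝ (Fin 3))
  obtain ⟨n, hn⟩ := exists_nat_gt (R / d)
  have hRd : R < d * ((n : ℝ) + 1) := by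
    rw [div_lt_iff₀ hd0] at hn; nlinarith
  have hsub : C ⊆ ball (0 : EuclideanSpace ℝ (Fin 3)) (d * ((n : ℝ) + 1)) :=
    hCR.trans (closedBall_subset_ball hRd)
  refine IntegrableOn.mono_set ⟨(hVm.norm.pow 3).restrict, ?_⟩ hsub
  rw [hasFiniteIntegral_iff_enorm]
  refine lt_of_le_of_lt (le_of_eq (lintegral_congr fun y => ?_)) (hball n)
  rw [Real.enorm_eq_ofReal (by positivity), ENNReal.ofReal_pow (norm_nonneg _), ofReal_norm]

end Cube

end Summit.NavierStokesRegularity.NavierStokesRegularity.Theorems.PowerGaugeEulerLiouville
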